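import Summits.CriticalPhenomena.PercolationContinuityZ3.Theorems.PercNearOneGluingNoHeavyLowerTailSahiE3LroAndStep
import Summits.CriticalPhenomena.PercolationContinuityZ3.Theorems.PercNearOneGluingNoHeavyLowerTailSahiE3LroTransport
import Summits.CriticalPhenomena.PercolationContinuityZ3.Theorems.PercNearOneGluingNoHeavyLowerTailSahiE3PatternCertificate
import Mathlib.Order.Fin.Tuple
import Mathlib.Tactic.Linarith
import Mathlib.Tactic.Ring
import Mathlib.Tactic.Positivity
import HarnessLib
import HarnessLib.Audit

/-!
# `NoHeavyLowerTail` (crux stmt-CriticalPhenomena-4575), Sahi programme P4 (Holley / monotone coupling):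
# SAHI'S `C₃` / KAHN'S CONJECTURE 5 FOR EVERY LINEAR READ-ONCE FIRST SLOT (product pattern marginals)

Support file (cell `prim-l12`, seat P4, generation 11; `--supports stmt-CriticalPhenomena-4575`).  No named facts, no sorries;
standard axioms; def-free (the formula is the right fold `Fin.foldr n (fun i b => bif ops i then (x i.castSucc || b)
else (x i.castSucc && b)) (x (Fin.last n))`, i.e. `x₀ ∘₀ (x₁ ∘₁ (⋯ ∘ₙ₋₁ xₙ))` with `∘ᵢ = ∨` iff `ops i`).

A LINEAR READ-ONCE slot is `U = {x | F((jᵢ ≤ x)ᵢ)}` for such a formula `F` and join-primes `j₀, …, jₙ`: it contains the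
principal filters (`x₀ ∧ ⋯ ∧ xₙ`), the hitting sets (`x₀ ∨ ⋯ ∨ xₙ`, cell P3 / `…SahiE3HitSlotProduct`), `↑j₀ ∪ ↑(j₁ ⊔ j₂)`
(`…SahiE3OrPairSlot`, there for all FKG measures) and the NEW infinite families `x₀ ∨ (x₁ ∧ ⋯ ∧ xₙ)`, `x₀ ∨ x₁ ∨ (x₂ ∧ x₃)`,
`x₀ ∨ (x₁ ∧ (x₂ ∨ x₃))` (the hard-core pattern `1+23+24` of the k = 5 atlas, HOME prim-l12-p4/STATUS), `x₀ ∧ (x₁ ∨ (x₂ ∧ x₃))`,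
… (2ᵏ⁻¹ patterns on `k` variables).
THEOREM `cert_lro`: under every PRODUCT weight on the pattern cube the slot carries the explicit ATTRIBUTION flow certificate
(induction along the formula: `…SahiE3LroOrStep.cert_or_step`, `…SahiE3LroAndStep.cert_and_step`, transported along
`Fin.consOrderIso` by `…SahiE3LroTransport.cert_transport`; Harris' inequality is carried along).
THEOREM `latticeE3_nonneg_of_lro`: hence, by `…SahiE3PatternCertificate.latticeE3_nonneg_of_patternCertificate`, Sahi's
`C₃` holds for `(U, A, B)` on every finite distributive lattice with a log-supermodular `μ ≥ 0` WHENEVER the pattern marginal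
`t ↦ m{x | (jᵢ ≤ x)ᵢ = t}` is a product weight — in particular for every product measure on a finite Boolean lattice with the
`jᵢ` distinct atoms (`…SahiE3LroCube`): Kahn's Conjecture 5 [Kahn, arXiv:2210.08653, Conj. 5] for every linear read-once
first slot, the other two increasing events arbitrary.  (For general FKG measures the attribution certificate fails already
for two primes; numerics and the paper proof: HOME prim-l12-p4/FROM-prim-l12-p4-gen11-LRO-SLOTS.md.)
-/

/-! ## Linear read-once slots: the induction and the lattice theorem -/

namespace Summit.CriticalPhenomena.PercolationContinuityZ3.Theorems.SahiE3LroSlot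

open Finset SahiE3LroLayers SahiE3LroOrStep SahiE3LroAndStep SahiE3LroTransport
open scoped BigOperators

/-- One step of the linear read-once evaluation `x₀ ∘₀ (x₁ ∘₁ (⋯ ∘ₙ₋₁ xₙ))` (a right fold over the operator list
`ops : Fin n → Bool`, `true = ∨`, `false = ∧`): peel off the head variable. [this work] -/
theorem lroEval_succ (n : ℕ) (ops : Fin (n + 1) → Bool) (x : Fin (n + 2) → Bool) :
    Fin.foldr (n + 1) (fun i b => bif ops i then (x i.castSucc || b) else (x i.castSucc && b)) (x (Fin.last (n + 1))) =
      (bif ops 0 then (x 0 || Fin.foldr n (fun i b => bif (Fin.tail ops) i then (Fin.tail x i.castSucc || b)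
          else (Fin.tail x i.castSucc && b)) (Fin.tail x (Fin.last n)))
        else (x 0 && Fin.foldr n (fun i b => bif (Fin.tail ops) i then (Fin.tail x i.castSucc || b)
          else (Fin.tail x i.castSucc && b)) (Fin.tail x (Fin.last n)))) := by
  rw [Fin.foldr_succ]
  have e1 : x (Fin.last (n + 1)) = Fin.tail x (Fin.last n) := by
    rw [Fin.tail, Fin.succ_last]
  have e2 : (fun i b => bif ops (Fin.succ i) then (x (Fin.succ i).castSucc || b) else (x (Fin.succ i).castSucc && b)) =
      (fun i b => bif (Fin.tail ops) i then (Fin.tail x i.castSucc || b) else (Fin.tail x i.castSucc && b)) := by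
    funext i b
    simp only [Fin.tail, Fin.succ_castSucc]
  simp only [Fin.castSucc_zero, e1, e2]

/-- **The attribution certificate of a linear read-once slot.**  For every `n`, every operator list `ops : Fin n → Bool`
(the formula `x₀ ∘₀ (x₁ ∘₁ (⋯ ∘ₙ₋₁ xₙ))`, `∘ᵢ = ∨` if `ops i = true`, `∧` otherwise) and every PRODUCT weight
`ν(x) = ∏ᵢ wᵢ(xᵢ)` (`w ≥ 0`) on the pattern cube `Fin (n+1) → Bool`: the slot `U = {x | the formula is true at x}` is an
up-set, Harris' inequality holds for `ν`, and `U` carries a flow certificate with exact deliveries (conditions (R0), (F0),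
(F≤), (cap), (K) with equality, (pair) of `…SahiE3PatternCertificate.phi_nonneg_of_patternCertificate`).  Induction along
the formula: `…SahiE3LroOrStep.cert_or_step` / `…SahiE3LroAndStep.cert_and_step`, transported along `Fin.consOrderIso`. [this work] -/
theorem cert_lro : ∀ (n : ℕ) (ops : Fin n → Bool) (w : Fin (n + 1) → Bool → ℝ) (_hw : ∀ i b, 0 ≤ w i b)
    (ν : (Fin (n + 1) → Bool) → ℝ) (_hν : ∀ t, ν t = ∏ i, w i (t i)) (U : Finset (Fin (n + 1) → Bool))
    (_hU : ∀ x, x ∈ U ↔ Fin.foldr n (fun i b => bif ops i then (x i.castSucc || b) else (x i.castSucc && b))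
      (x (Fin.last n)) = true),
    IsUpperSet (U : Set (Fin (n + 1) → Bool)) ∧
    (∀ S S' : Finset (Fin (n + 1) → Bool), IsUpperSet (S : Set (Fin (n + 1) → Bool)) →
      IsUpperSet (S' : Set (Fin (n + 1) → Bool)) →
      (∑ t ∈ S, ν t) * (∑ t ∈ S', ν t) ≤ (∑ t, ν t) * ∑ t ∈ S ∩ S', ν t) ∧
    ∃ (R : (Fin (n + 1) → Bool) → ℝ) (Fl : (Fin (n + 1) → Bool) → (Fin (n + 1) → Bool) → ℝ),
      (∀ t ∈ U, 0 ≤ R t) ∧ (∀ t s, 0 ≤ Fl t s) ∧ (∀ t s, Fl t s ≠ 0 → s ≤ t) ∧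
      (∀ t ∈ U, R t + ∑ s ∈ Uᶜ, Fl t s ≤ (∑ r, ν r) * ((∑ r, ν r) + ∑ r ∈ Uᶜ, ν r) * ν t) ∧
      (∀ s ∈ Uᶜ, ∑ t ∈ U, Fl t s = (∑ r, ν r) * (∑ r ∈ U, ν r) * ν s) ∧
      (∀ S S' : Finset (Fin (n + 1) → Bool), IsUpperSet (S : Set (Fin (n + 1) → Bool)) →
        IsUpperSet (S' : Set (Fin (n + 1) → Bool)) →
        (∑ r, ν r) * ((∑ t ∈ S, ν t) * (∑ t ∈ S' ∩ U, ν t) + (∑ t ∈ S', ν t) * (∑ t ∈ S ∩ U, ν t))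
          - (∑ r ∈ U, ν r) * (∑ t ∈ S, ν t) * (∑ t ∈ S', ν t) ≤ ∑ t ∈ (S ∩ S') ∩ U, R t) := by
  intro n
  induction n with
  | zero =>
    intro ops w hw ν hν U hU
    -- one variable: `U = {x | x 0}`: the OR-step over the one-point pattern `Fin 0 → Bool` with the empty slot
    have hU0 : ∀ x : Fin 1 → Bool, x ∈ U ↔ x 0 = true := fun x => by simpa [Fin.foldr_zero] using hU x
    have hνx : ∀ x : Fin 1 → Bool, ν x = w 0 (x 0) := fun x => by rw [hν, Fin.prod_univ_one]
    obtain ⟨ν₂, hν₂⟩ : ∃ f : Bool × (Fin 0 → Bool) → ℝ, ∀ y, f y = (if y.1 = true then w 0 true else w 0 false) * 1 :=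
      ⟨_, fun _ => rfl⟩
    obtain ⟨U₂, hU₂⟩ : ∃ V : Finset (Bool × (Fin 0 → Bool)), ∀ y, y ∈ V ↔ (y.1 = true ∨ y.2 ∈ (∅ : Finset (Fin 0 → Bool))) :=
      ⟨univ.filter fun y => y.1 = true, fun y => by simp⟩
    obtain ⟨R₀, Fl₀, c1, c2, c3, c4, c5, c6⟩ := cert_empty (Q := Fin 0 → Bool) (fun _ => (1:ℝ))
    have hH₀ := harris_subsingleton (P := Fin 0 → Bool) (fun _ => (1:ℝ))
    have hE : IsUpperSet (((∅ : Finset (Fin 0 → Bool))) : Set (Fin 0 → Bool)) := by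
      rw [Finset.coe_empty]; exact isUpperSet_empty
    obtain ⟨R₂, Fl₂, d1, d2, d3, d4, d5, d6⟩ := cert_or_step (Q := Fin 0 → Bool) (ν' := fun _ => (1:ℝ))
      (fun _ => zero_le_one) (fun S S' _ _ => hH₀ S S') ∅ hE R₀ Fl₀ c1 c2 c3 c4 c5 c6
      (hw 0 true) (hw 0 false) ν₂ (fun t => by rw [hν₂]; simp) (fun t => by rw [hν₂]; simp) U₂ hU₂
    have hH₂ := harris_layers (Q := Fin 0 → Bool) (ν' := fun _ => (1:ℝ)) (fun _ => zero_le_one)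
      (fun S S' _ _ => hH₀ S S') (hw 0 true) (hw 0 false) ν₂ (fun t => by rw [hν₂]; simp) (fun t => by rw [hν₂]; simp)
    let e := Fin.consOrderIso (fun _ : Fin 1 => Bool)
    have hes : ∀ y : Fin 1 → Bool, e.symm y = (y 0, Fin.tail y) := fun y => rfl
    have hνe : ∀ y : Fin 1 → Bool, ν y = ν₂ (e.symm y) := fun y => by
      rw [hes, hν₂, hνx]; cases y 0 <;> simp
    have hUe : ∀ y : Fin 1 → Bool, y ∈ U ↔ e.symm y ∈ U₂ := fun y => by
      rw [hes, hU0, hU₂]; simp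
    refine ⟨?_, harris_transport e _ hνe hH₂, cert_transport e d1 d2 d3 d4 d5 d6 _ hνe U hUe⟩
    intro x y hxy hx
    simp only [Finset.mem_coe] at hx ⊢
    rw [hU0] at hx ⊢
    have h0 : x 0 ≤ y 0 := hxy 0
    rw [hx] at h0
    exact top_le_iff.mp h0
  | succ n ih =>
    intro ops w hw ν hν U hU
    obtain ⟨G, hG⟩ : ∃ G : Finset (Fin (n + 1) → Bool), ∀ t, t ∈ G ↔
        Fin.foldr n (fun i b => bif (Fin.tail ops) i then (t i.castSucc || b) else (t i.castSucc && b))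
          (t (Fin.last n)) = true :=
      ⟨univ.filter fun t => Fin.foldr n (fun i b => bif (Fin.tail ops) i then (t i.castSucc || b)
        else (t i.castSucc && b)) (t (Fin.last n)) = true, fun t => by simp⟩
    obtain ⟨ν', hν'⟩ : ∃ f : (Fin (n + 1) → Bool) → ℝ, ∀ t, f t = ∏ i, w i.succ (t i) := ⟨_, fun _ => rfl⟩
    obtain ⟨hGup, hH', R', Fl', c1, c2, c3, c4, c5, c6⟩ :=
      ih (Fin.tail ops) (fun i => w i.succ) (fun i b => hw _ _) ν' hν' G hG
    have hν'0 : ∀ t, 0 ≤ ν' t := fun t => by rw [hν']; exact Finset.prod_nonneg fun i _ => hw _ _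
    obtain ⟨ν₂, hν₂⟩ : ∃ f : Bool × (Fin (n + 1) → Bool) → ℝ, ∀ y,
        f y = (if y.1 = true then w 0 true else w 0 false) * ν' y.2 := ⟨_, fun _ => rfl⟩
    have hν₂t : ∀ t, ν₂ (true, t) = w 0 true * ν' t := fun t => by rw [hν₂]; simp
    have hν₂f : ∀ t, ν₂ (false, t) = w 0 false * ν' t := fun t => by rw [hν₂]; simp
    let e := Fin.consOrderIso (fun _ : Fin (n + 2) => Bool)
    have hes : ∀ y : Fin (n + 2) → Bool, e.symm y = (y 0, Fin.tail y) := fun y => rfl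
    have hνe : ∀ y : Fin (n + 2) → Bool, ν y = ν₂ (e.symm y) := fun y => by
      rw [hes, hν₂, hν, Fin.prod_univ_succ, hν']
      cases y 0 <;> simp [Fin.tail]
    have hH₂ := harris_layers hν'0 hH' (hw 0 true) (hw 0 false) ν₂ hν₂t hν₂f
    have hev : ∀ y : Fin (n + 2) → Bool, y ∈ U ↔ (bif ops 0 then (y 0 || decide (Fin.tail y ∈ G))
        else (y 0 && decide (Fin.tail y ∈ G))) = true := fun y => by
      rw [hU, lroEval_succ]
      have hd : decide (Fin.tail y ∈ G) = Fin.foldr n (fun i b => bif (Fin.tail ops) i then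
          (Fin.tail y i.castSucc || b) else (Fin.tail y i.castSucc && b)) (Fin.tail y (Fin.last n)) := by
        by_cases h : Fin.tail y ∈ G
        · rw [decide_eq_true h, ((hG _).1 h)]
        · rw [decide_eq_false h]
          rcases Bool.eq_false_or_eq_true (Fin.foldr n (fun i b => bif (Fin.tail ops) i then
            (Fin.tail y i.castSucc || b) else (Fin.tail y i.castSucc && b)) (Fin.tail y (Fin.last n))) with h1 | h1
          · exact absurd ((hG _).2 h1) h
          · rw [h1]
      rw [hd]
    cases ho : ops 0
    · -- AND-step
      obtain ⟨U₂, hU₂⟩ : ∃ V : Finset (Bool × (Fin (n + 1) → Bool)), ∀ y, y ∈ V ↔ (y.1 = true ∧ y.2 ∈ G) :=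
        ⟨univ.filter fun y => y.1 = true ∧ y.2 ∈ G, fun y => by simp⟩
      obtain ⟨R₂, Fl₂, d1, d2, d3, d4, d5, d6⟩ := cert_and_step hν'0 hH' G hGup
        R' Fl' c1 c2 c3 c4 c5 c6 (hw 0 true) (hw 0 false) ν₂ hν₂t hν₂f U₂ hU₂
      have hUe : ∀ y : Fin (n + 2) → Bool, y ∈ U ↔ e.symm y ∈ U₂ := fun y => by
        rw [hev, ho, hes, hU₂]; simp
      refine ⟨?_, harris_transport e _ hνe hH₂, cert_transport e d1 d2 d3 d4 d5 d6 _ hνe U hUe⟩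
      intro x y hxy hx
      simp only [Finset.mem_coe] at hx ⊢
      rw [hUe, hU₂] at hx ⊢
      rw [hes] at hx ⊢
      refine ⟨?_, hGup (show Fin.tail x ≤ Fin.tail y from fun i => hxy i.succ) hx.2⟩
      have h0 : x 0 ≤ y 0 := hxy 0
      have hx0 : x 0 = true := hx.1
      rw [hx0] at h0
      exact top_le_iff.mp h0
    · -- OR-step
      obtain ⟨U₂, hU₂⟩ : ∃ V : Finset (Bool × (Fin (n + 1) → Bool)), ∀ y, y ∈ V ↔ (y.1 = true ∨ y.2 ∈ G) :=
        ⟨univ.filter fun y => y.1 = true ∨ y.2 ∈ G, fun y => by simp⟩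
      obtain ⟨R₂, Fl₂, d1, d2, d3, d4, d5, d6⟩ := cert_or_step hν'0 hH' G hGup
        R' Fl' c1 c2 c3 c4 c5 c6 (hw 0 true) (hw 0 false) ν₂ hν₂t hν₂f U₂ hU₂
      have hUe : ∀ y : Fin (n + 2) → Bool, y ∈ U ↔ e.symm y ∈ U₂ := fun y => by
        rw [hev, ho, hes, hU₂]; simp
      refine ⟨?_, harris_transport e _ hνe hH₂, cert_transport e d1 d2 d3 d4 d5 d6 _ hνe U hUe⟩
      intro x y hxy hx
      simp only [Finset.mem_coe] at hx ⊢
      rw [hUe, hU₂] at hx ⊢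
      rw [hes] at hx ⊢
      rcases hx with hx0 | hxG
      · left
        have h0 : x 0 ≤ y 0 := hxy 0
        have hx0' : x 0 = true := hx0
        rw [hx0'] at h0
        exact top_le_iff.mp h0
      · exact Or.inr (hGup (show Fin.tail x ≤ Fin.tail y from fun i => hxy i.succ) hxG)



/-! ### The lattice theorem: Sahi's `C₃` for a linear read-once slot whenever the pattern marginal is a product -/

section Lattice

open Literature.Probability.LatticeModels

variable {α : Type*} [DistribLattice α] [Fintype α] [DecidableEq α] [DecidableLE α]

open scoped Classical in
/-- **Sahi's `C₃` / Kahn's Conjecture 5 for every LINEAR READ-ONCE first slot with a product pattern marginal.**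
`L` a finite distributive lattice, `μ ≥ 0` log-supermodular, `j₀, …, jₙ` join-primes, `A, B` up-sets, and the slot
`U = {x | F((jᵢ ≤ x)ᵢ)}` for a linear read-once formula `F = x₀ ∘₀ (x₁ ∘₁ (⋯ ∘ₙ₋₁ xₙ))` (`∘ᵢ = ∨` if `ops i = true`,
else `∧`; e.g. `j₀ ≤ x ∨ (j₁ ≤ x ∧ (j₂ ≤ x ∨ j₃ ≤ x))` — the pattern `1+23+24` —, `↑j₀ ∪ ↑(j₁ ⊔ ⋯ ⊔ jₙ)`, hitting sets,
principal filters).  If the pattern marginal `t ↦ m{x | (jᵢ ≤ x)ᵢ = t}` is a PRODUCT weight `∏ᵢ wᵢ(tᵢ)` (`w ≥ 0`) — the case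
of every product measure on a Boolean lattice with `jᵢ` distinct atoms — then `0 ≤ latticeE3 μ U A B`.
Proof: the attribution certificate `cert_lro` fed into `…SahiE3PatternCertificate.latticeE3_nonneg_of_patternCertificate`.
This is Kahn's Conjecture 5 [Kahn, arXiv:2210.08653, Conj. 5] for every linear read-once first slot (the second and third events arbitrary). [this work] -/
theorem latticeE3_nonneg_of_lro {μ : α → ℝ} (hμ₀ : 0 ≤ μ)
    (hμ : ∀ a b, μ a * μ b ≤ μ (a ⊓ b) * μ (a ⊔ b)) (n : ℕ) (ops : Fin n → Bool) {j : Fin (n + 1) → α}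
    (hj : ∀ i, SupPrime (j i)) {F : (Fin (n + 1) → Bool) → Finset α}
    (hF : ∀ (t : Fin (n + 1) → Bool) (x : α), x ∈ F t ↔ ∀ i, (j i ≤ x ↔ t i = true))
    {A B : Finset α} (hA : IsUpperSet (A : Set α)) (hB : IsUpperSet (B : Set α))
    (w : Fin (n + 1) → Bool → ℝ) (hw : ∀ i b, 0 ≤ w i b) (hν : ∀ t, mass μ (F t) = ∏ i, w i (t i))
    (U' : Finset (Fin (n + 1) → Bool))
    (hU' : ∀ t, t ∈ U' ↔ Fin.foldr n (fun i b => bif ops i then (t i.castSucc || b) else (t i.castSucc && b))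
      (t (Fin.last n)) = true) :
    0 ≤ latticeE3 μ (univ.filter fun x => (fun i => decide (j i ≤ x)) ∈ U') A B := by
  obtain ⟨-, -, R, Fl, h1, h2, h3, h4, h5, h6⟩ :=
    cert_lro n ops w hw (fun t => ∏ i, w i (t i)) (fun _ => rfl) U' hU'
  refine SahiE3PatternCertificate.latticeE3_nonneg_of_patternCertificate hμ₀ hμ hj hF hA hB U'
    (fun t => ∏ i, w i (t i)) (fun t => (hν t).symm) R Fl h1 h2 h3 h4 (fun s hs => (h5 s hs).ge) ?_
  intro S S' hS hS'
  have hz : ∑ s ∈ (S ∩ S') ∩ U'ᶜ, (∑ t ∈ U', Fl t s - (∑ r : Fin (n + 1) → Bool, ∏ i, w i (r i)) *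
      (∑ r ∈ U', ∏ i, w i (r i)) * ∏ i, w i (s i)) = 0 :=
    Finset.sum_eq_zero fun s hs => by rw [h5 s (Finset.mem_inter.1 hs).2, sub_self]
  rw [hz, add_zero]
  exact h6 S S' hS hS'

end Lattice

end Summit.CriticalPhenomena.PercolationContinuityZ3.Theorems.SahiE3LroSlot
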